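import Summits.AnomalousDissipation.AnomalousDissipation.Theorems.LaminarNeverLoud.Negative.Scaling

/-!
# Tier C of the stub plan for `stub_loudCoatDecades` (line `idea-sketch-ideator2`, card `euler-core-coat-readout`),
# crux stmt-AnomalousDissipation-2986 (`MirrorVariety.GalerkinSteadyZerothLaw`): the heart in FORCE coordinates implies the heart

`STUB-PLAN-stub_loudCoatDecades.md` §2.2 tier C (k3-H4/H5 = k1-H6): the registered heart `stub_loudCoatDecades`
(= `LoudCoatDecades`: one exact-Euler core shape carries, along clamp viscosities `νlo j → 0⁺` and frequently in
`N`, CONNECTED sets of loud bounded amplitude-clamped COATS whose clamp viscosities cover `[νlo j, ρ νlo j]`,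
`ρ² ε₁ > M`) follows from the same statement in FORCE coordinates, the *steady tube ladder*: one core shape `Cfun`,
budgets `E`, `ε > 0`, a loudness ratio `q ≥ 1` and a viscosity span `r > q²`, force viscosities `a j → 0⁺`, and for
every `j`, frequently in `N`, a CONNECTED set `Z` of Galerkin steady states of the FIXED force vector `C`
(`galerkinRHS (modes N) ν' C c = 0`) with `energy c ≤ E`, `ε ≤ dissipation ν' c ≤ q ε`, whose viscosities cover
`[a j, r · a j]`.

* `coatFamily_of_forceFamily` (C1): the coat chart run along a connected family —
  `Φ(ν', c) = (E_C ν'/D, (E_C/D) • c - C)`, `D := dissipation ν' c`, is continuous on `{D > 0} ⊇ Z`, so `Φ '' Z`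
  is connected (`IsConnected.image`); pointwise it lands in coats (the chart is onto: power identity
  `D = ∑ Re⟪C k, c k⟫`, affinity of `galerkinRHS` in the force, bidegree-`(1,2)` homogeneity `galerkinRHS_scale`);
  the windows transport as `energy ≤ E (E_C/ε)²`, `dissipation ∈ [E_C³/(qε)², E_C³/ε²]`
  (`dissipation (αν') (α • c) = α³ D = E_C³/D²`), and the clamp viscosities cover `[a E_C/ε, b E_C/(qε)]`
  (`IsPreconnected.Icc_subset` on the connected image `fst '' Φ '' Z ⊆ ℝ`: at `ν' = a` the clamp viscosity is
  `≤ a E_C/ε`, at `ν' = b` it is `≥ b E_C/(qε)`).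
* `stub_loudCoatOfLadder` (C2, REGISTERED sub-goal, hypothesis = the force-coordinate ladder inlined, conclusion =
  the registered signature of `stub_loudCoatDecades` VERBATIM): bookkeeping with the `j`-, `N`-free constants
  `E_C := ∑_{modes K₀} ‖Cfun k‖²` (level-independent once `N ≥ K₀`), `νlo j := a j · E_C/ε`, `ρ := r/q`,
  `ε₁ := E_C³/(qε)²`, `M := E_C³/ε²`, `E₁ := E (E_C/ε)²`; `M < ρ² ε₁ ⟺ q² < r`.

So after this file the skeleton's heart may be re-registered in force coordinates (`stub_steadyTubeLadder`), where
the numerics, the sibling crux's Newton–Kantorovich stubs and the tube lemmas (`…StubLoudCoatTubeTools`) act.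
Nothing here is asserted about the ladder itself.  Design note: the pointwise chart `coat_chart_onto` and the
bookkeeping lemmas `energy_pos` / `energy_restrict_eq` are LANDED (`Theorems/MirrorVarietyGalerkinSteadyZerothLaw{StubCoatChartOnto,Line}.lean`,
p90004 / p88897) but those modules were import-unreachable (accepted, hub build pending) when this file was written,
so it carries PRIVATE copies (`chartOnto`, `energyPos`, `energyRestrict`) over the built `LaminarNeverLoud.Negative`
vocabulary; the public declarations are new.  References: the plan and sketch
`Cruxes/GalerkinSteadyZerothLaw/STUB-PLAN-stub_loudCoatDecades.md`, `StubPlanLoudCoatDecadesSketch.lean`;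
Temam, *Navier–Stokes Equations* (1979), Ch. II (1.29) (power identity of Galerkin steady states).
-/

noncomputable section

-- `Summit.<Summit>.<Problem>` is the tree's mandated summit-side namespace (CONVENTIONS §2); deliberate duplicate.
set_option linter.dupNamespace false

open scoped InnerProductSpace Topology
open MeasureTheory Filter Set UnitAddTorus
open Literature.Analysis.FunctionSpaces Literature.Analysis.FunctionSpaces.Torus
open Literature.Analysis.FluidPDE Literature.Analysis.FluidPDE.Torus

namespace Summit.AnomalousDissipation.AnomalousDissipation.Theorems.GalerkinSteadyZerothLaw

open Summit.AnomalousDissipation.AnomalousDissipation.Theorems.LaminarNeverLoud.Negative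
  (modes energy dissipation modes_symm energy_nonneg dissipation_nonpos_of_nonpos energy_smul dissipation_smul
    galerkinRHS_scale dissipation_eq_power)

/-! ## §0 Small facts over the built vocabulary -/

/-- The coefficient dissipation `(ν, c) ↦ dissipation ν c` is continuous (a polynomial in finitely many coordinates).
[folklore] -/
theorem continuous_dissipation_uncurry {N : ℕ} :
    Continuous fun p : ℝ × (↥(modes (Fin 3) N) → EuclideanSpace ℂ (Fin 3)) => dissipation p.1 p.2 := by
  unfold dissipation
  refine continuous_fst.mul (continuous_const.mul ?_)
  refine continuous_finsetSum _ fun k _ => continuous_const.mul ?_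
  exact ((continuous_apply k).comp continuous_snd).norm.pow 2

/-- (Private copy of the landed `energy_pos`, module import-unreachable at the time of writing.)
A nonzero coefficient vector has positive energy. [folklore] -/
private theorem energyPos {N : ℕ} {C : ↥(modes (Fin 3) N) → EuclideanSpace ℂ (Fin 3)} (hC : C ≠ 0) :
    0 < energy C := by
  obtain ⟨k, hk⟩ : ∃ k, C k ≠ 0 := by
    by_contra h
    push Not at h
    exact hC (funext h)
  have hle : ‖C k‖ ^ 2 ≤ energy C :=
    Finset.single_le_sum (f := fun k => ‖C k‖ ^ 2) (fun _ _ => sq_nonneg _) (Finset.mem_univ k)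
  exact lt_of_lt_of_le (by positivity) hle

/-- (Private copy of the landed `energy_restrict_eq`, module import-unreachable at the time of writing.)
The energy of the restriction of a family supported in `modes K₀` is the same at every level `N ≥ K₀`. [folklore] -/
private theorem energyRestrict {K₀ N : ℕ} {Cfun : (Fin 3 → ℤ) → EuclideanSpace ℂ (Fin 3)}
    (hsupp : ∀ k ∉ modes (Fin 3) K₀, Cfun k = 0) (hKN : K₀ ≤ N) :
    energy (fun k : ↥(modes (Fin 3) N) => Cfun k) = ∑ k ∈ modes (Fin 3) K₀, ‖Cfun k‖ ^ 2 := by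
  unfold energy
  rw [Finset.sum_coe_sort (modes (Fin 3) N) (fun k => ‖Cfun k‖ ^ 2)]
  symm
  refine Finset.sum_subset ?_ ?_
  · intro k hk
    rw [Finset.mem_erase] at hk ⊢
    exact ⟨hk.1, freqBall_mono hKN hk.2⟩
  · intro k _ hk
    rw [hsupp k hk, norm_zero]
    ring

/-- (Private copy of the landed `coat_chart_onto`, p90004, module import-unreachable at the time of writing.)
The coat chart is ONTO: every Galerkin steady state `c` of a real solenoidal force vector `C` at viscosity `ν` with
`D := dissipation ν c > 0` is a gauged coat over `C`: with `α := energy C / D`, `h := α • c - C` is real solenoidal,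
`ℓ²`-orthogonal to `C` (power identity `D = ∑ Re⟪C k, c k⟫`, `dissipation_eq_power`), and the unforced residual of
`C + h = α • c` at viscosity `α ν` is `(-(α²)) • C` (affinity of `galerkinRHS` in the force, `leraySym_of_transversal`,
and the bidegree-`(1, 2)` homogeneity `galerkinRHS_scale`). [folklore] -/
private theorem chartOnto {N : ℕ} {C c : ↥(modes (Fin 3) N) → EuclideanSpace ℂ (Fin 3)} {ν : ℝ}
    (hC : C ∈ galerkinSubspace (modes (Fin 3) N)) (hc : c ∈ galerkinSubspace (modes (Fin 3) N))
    (h0 : galerkinRHS (modes (Fin 3) N) ν C c = 0) (hD : 0 < dissipation ν c) :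
    (energy C / dissipation ν c) • c - C ∈ galerkinSubspace (modes (Fin 3) N) ∧
      (∑ k, (inner ℂ (C k) (((energy C / dissipation ν c) • c - C) k)).re) = 0 ∧
      galerkinRHS (modes (Fin 3) N) (energy C / dissipation ν c * ν) 0 (C + ((energy C / dissipation ν c) • c - C)) =
        (-((energy C / dissipation ν c) ^ 2)) • C := by
  -- adapted from `Theorems/MirrorVarietyGalerkinSteadyZerothLawStubCoatChartOnto.lean` (p90004)
  have hS : ∀ k ∈ modes (Fin 3) N, -k ∈ modes (Fin 3) N := modes_symm N
  have hpow : dissipation ν c = ∑ k, (inner ℂ (C k) (c k)).re := dissipation_eq_power hS hC.1 hc h0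
  have hres : galerkinRHS (modes (Fin 3) N) ν 0 c = -C := by
    funext k
    have hk := congrFun h0 k
    have haff : galerkinRHS (modes (Fin 3) N) ν C c k =
        galerkinRHS (modes (Fin 3) N) ν 0 c k + leraySym (k : Fin 3 → ℤ) (coeffExt (modes (Fin 3) N) C k) := by
      simp only [galerkinRHS_apply, galerkinField_def, coeffExt_zero, Pi.zero_apply, zero_sub, leraySym_sub,
        leraySym_neg]
      abel
    rw [haff, coeffExt_coe, leraySym_of_transversal (hC.2 k)] at hk
    rw [Pi.neg_apply]
    exact eq_neg_of_add_eq_zero_left hk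
  have hD0 : dissipation ν c ≠ 0 := hD.ne'
  set α : ℝ := energy C / dissipation ν c with hα
  have hαD : α * dissipation ν c = energy C := by
    rw [hα]
    exact div_mul_cancel₀ (energy C) hD0
  refine ⟨(galerkinSubspace _).sub_mem ((galerkinSubspace _).smul_mem α hc) hC, ?_, ?_⟩
  · have hterm : ∀ k : ↥(modes (Fin 3) N),
        (inner ℂ (C k) ((α • c - C) k)).re = α * (inner ℂ (C k) (c k)).re - ‖C k‖ ^ 2 := by
      intro k
      have e1 : (α • c - C) k = Complex.ofReal α • c k - C k := by
        rw [Pi.sub_apply, Pi.smul_apply, RCLike.real_smul_eq_coe_smul (K := ℂ)]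
        rfl
      have e2 : (inner ℂ (C k) (C k)).re = ‖C k‖ ^ 2 := by
        rw [← RCLike.re_to_complex, inner_self_eq_norm_sq]
      rw [e1, inner_sub_right, inner_smul_right, Complex.sub_re, Complex.mul_re, Complex.ofReal_re,
        Complex.ofReal_im, zero_mul, sub_zero, e2]
    rw [Finset.sum_congr rfl fun k _ => hterm k, Finset.sum_sub_distrib, ← Finset.mul_sum, ← hpow, hαD]
    unfold energy
    exact sub_self _
  · have hsc := galerkinRHS_scale α ν (0 : ↥(modes (Fin 3) N) → EuclideanSpace ℂ (Fin 3)) c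
    rw [smul_zero] at hsc
    rw [add_sub_cancel, hsc, hres, smul_neg, neg_smul]

/-! ## §1 C1: chart transport of a connected force-coordinate family -/

/-- **C1 `coatFamily_of_forceFamily`** (chart transport of a connected force-coordinate family).  A CONNECTED set
`Z` of Galerkin steady states of the FIXED real solenoidal force vector `C` — `galerkinRHS (modes N) ν' C c = 0`,
`energy c ≤ E`, `ε ≤ dissipation ν' c ≤ q ε` — whose viscosities cover `[a, b]` (`0 < a ≤ b`) is carried by the
chart `Φ(ν', c) = (E_C ν'/D, (E_C/D) • c - C)` (`D := dissipation ν' c`, `E_C := energy C`; continuous on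
`{D > 0} ⊇ Z`) to a CONNECTED family of amplitude-clamped coats over `C` with `energy (C + h) ≤ E (E_C/ε)²`,
`E_C³/(qε)² ≤ dissipation ν (C + h) ≤ E_C³/ε²`, whose clamp viscosities cover `[a E_C/ε, b E_C/(qε)]`. [folklore] -/
theorem coatFamily_of_forceFamily (N : ℕ) (C : ↥(modes (Fin 3) N) → EuclideanSpace ℂ (Fin 3))
    (hC : C ∈ galerkinSubspace (modes (Fin 3) N))
    (Z : Set (ℝ × (↥(modes (Fin 3) N) → EuclideanSpace ℂ (Fin 3)))) (E ε q a b : ℝ) (hε : 0 < ε)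
    (ha : 0 < a) (hab : a ≤ b) (hZ : IsConnected Z)
    (hZst : ∀ p ∈ Z, p.2 ∈ galerkinSubspace (modes (Fin 3) N) ∧ galerkinRHS (modes (Fin 3) N) p.1 C p.2 = 0 ∧
      energy p.2 ≤ E ∧ ε ≤ dissipation p.1 p.2 ∧ dissipation p.1 p.2 ≤ q * ε)
    (hcov : Icc a b ⊆ Prod.fst '' Z) :
    ∃ K : Set (ℝ × (↥(modes (Fin 3) N) → EuclideanSpace ℂ (Fin 3))), IsConnected K ∧
      (∀ p ∈ K, (p.2 ∈ galerkinSubspace (modes (Fin 3) N) ∧ (∑ k, (inner ℂ (C k) (p.2 k)).re) = 0 ∧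
          ∃ s : ℝ, galerkinRHS (modes (Fin 3) N) p.1 0 (C + p.2) = (-s) • C) ∧
        energy (C + p.2) ≤ E * (energy C / ε) ^ 2 ∧
        energy C ^ 3 / (q * ε) ^ 2 ≤ dissipation p.1 (C + p.2) ∧ dissipation p.1 (C + p.2) ≤ energy C ^ 3 / ε ^ 2) ∧
      Icc (a * (energy C / ε)) (b * (energy C / (q * ε))) ⊆ Prod.fst '' K := by
  have hEC : 0 ≤ energy C := energy_nonneg C
  -- the chart `Φ = (α ν', α • c - C)`, `α = E_C / D`, kept opaque behind equation lemmas
  obtain ⟨α, hα⟩ : ∃ α : ℝ × (↥(modes (Fin 3) N) → EuclideanSpace ℂ (Fin 3)) → ℝ,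
      ∀ p, α p = energy C / dissipation p.1 p.2 := ⟨_, fun _ => rfl⟩
  obtain ⟨Φ, hΦ⟩ : ∃ Φ : ℝ × (↥(modes (Fin 3) N) → EuclideanSpace ℂ (Fin 3)) →
      ℝ × (↥(modes (Fin 3) N) → EuclideanSpace ℂ (Fin 3)), ∀ p, Φ p = (α p * p.1, α p • p.2 - C) :=
    ⟨_, fun _ => rfl⟩
  have hDpos : ∀ p ∈ Z, 0 < dissipation p.1 p.2 := fun p hp => hε.trans_le (hZst p hp).2.2.2.1
  have hαcont : ContinuousOn α Z := by
    have e : α = fun p => energy C / dissipation p.1 p.2 := funext hα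
    rw [e]
    refine continuousOn_const.div continuous_dissipation_uncurry.continuousOn ?_
    exact fun p hp => (hDpos p hp).ne'
  have hΦcont : ContinuousOn Φ Z := by
    have e : Φ = fun p => (α p * p.1, α p • p.2 - C) := funext hΦ
    rw [e]
    exact (hαcont.mul continuous_fst.continuousOn).prodMk
      ((hαcont.smul continuous_snd.continuousOn).sub continuousOn_const)
  -- pointwise facts along `Z`
  have hαle : ∀ p ∈ Z, α p ≤ energy C / ε := fun p hp => by
    rw [hα p]
    exact div_le_div_of_nonneg_left hEC hε (hZst p hp).2.2.2.1
  have hαge : ∀ p ∈ Z, energy C / (q * ε) ≤ α p := fun p hp => by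
    rw [hα p]
    exact div_le_div_of_nonneg_left hEC (hDpos p hp) (hZst p hp).2.2.2.2
  have hαnn : ∀ p ∈ Z, 0 ≤ α p := fun p hp => by
    rw [hα p]
    exact div_nonneg hEC (hDpos p hp).le
  have hα3 : ∀ p ∈ Z, α p ^ 3 * dissipation p.1 p.2 = energy C ^ 3 / dissipation p.1 p.2 ^ 2 := fun p hp => by
    have hD0 : dissipation p.1 p.2 ≠ 0 := (hDpos p hp).ne'
    rw [hα p]
    field_simp
  refine ⟨Φ '' Z, hZ.image Φ hΦcont, ?_, ?_⟩
  · rintro _ ⟨p, hp, rfl⟩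
    obtain ⟨hc, h0, hE, hDlo, hDhi⟩ := hZst p hp
    have hD := hDpos p hp
    obtain ⟨hmem, horth, hres⟩ := chartOnto hC hc h0 hD
    rw [← hα p] at hmem horth hres
    rw [hΦ p]
    dsimp only
    refine ⟨⟨hmem, horth, α p ^ 2, hres⟩, ?_, ?_, ?_⟩
    · -- energy: `energy (α • c) = α² energy c ≤ (E_C/ε)² E`
      rw [add_sub_cancel, energy_smul, mul_comm]
      have hE0 : 0 ≤ E := (energy_nonneg _).trans hE
      exact mul_le_mul hE (pow_le_pow_left₀ (hαnn p hp) (hαle p hp) 2) (sq_nonneg _) hE0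
    · -- dissipation floor: `E_C³/(qε)² ≤ E_C³/D² = α³ D`
      rw [add_sub_cancel, dissipation_smul, hα3 p hp]
      refine div_le_div_of_nonneg_left (pow_nonneg hEC 3) (pow_pos hD 2) ?_
      exact pow_le_pow_left₀ hD.le hDhi 2
    · -- dissipation ceiling: `α³ D = E_C³/D² ≤ E_C³/ε²`
      rw [add_sub_cancel, dissipation_smul, hα3 p hp]
      refine div_le_div_of_nonneg_left (pow_nonneg hEC 3) (pow_pos hε 2) ?_
      exact pow_le_pow_left₀ hε.le hDlo 2
  · -- coverage of the clamp viscosities: the connected image `g '' Z ⊆ ℝ`, `g := fst ∘ Φ`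
    have himg : Prod.fst '' (Φ '' Z) = (fun p => α p * p.1) '' Z := by
      rw [Set.image_image]
      refine Set.image_congr fun p _ => ?_
      rw [hΦ p]
    rw [himg]
    have hgcont : ContinuousOn (fun p : ℝ × (↥(modes (Fin 3) N) → EuclideanSpace ℂ (Fin 3)) => α p * p.1) Z :=
      hαcont.mul continuous_fst.continuousOn
    have hpre : IsPreconnected ((fun p : ℝ × (↥(modes (Fin 3) N) → EuclideanSpace ℂ (Fin 3)) => α p * p.1) '' Z) :=
      hZ.isPreconnected.image _ hgcont
    obtain ⟨pa, hpa, hpa1⟩ := hcov ⟨le_rfl, hab⟩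
    obtain ⟨pb, hpb, hpb1⟩ := hcov ⟨hab, le_rfl⟩
    have hb : 0 ≤ b := ha.le.trans hab
    refine Subset.trans (Icc_subset_Icc ?_ ?_) (hpre.Icc_subset (mem_image_of_mem _ hpa) (mem_image_of_mem _ hpb))
    · -- at `ν' = a` the clamp viscosity is `≤ a E_C/ε`
      show α pa * pa.1 ≤ a * (energy C / ε)
      rw [hpa1, mul_comm]
      exact mul_le_mul_of_nonneg_left (hαle pa hpa) ha.le
    · -- at `ν' = b` the clamp viscosity is `≥ b E_C/(qε)`
      show b * (energy C / (q * ε)) ≤ α pb * pb.1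
      rw [hpb1, mul_comm (α pb)]
      exact mul_le_mul_of_nonneg_left (hαge pb hpb) hb

/-! ## §2 C2: the registered sub-goal — the force-coordinate ladder implies the registered heart verbatim -/

/-- **stub_loudCoatOfLadder** (C2, REGISTERED sub-goal of the line `idea-sketch-ideator2`; bookkeeping).  The heart
`stub_loudCoatDecades` in FORCE coordinates implies the registered heart VERBATIM: from one core shape `Cfun`
(support `modes K₀`), budgets `E`, `ε > 0`, a loudness ratio `q ≥ 1`, a viscosity span `r > q²`, force viscosities
`a j → 0⁺`, and — for every `j`, frequently in `N` — the exact Euler core `C = Cfun|modes N` together with a CONNECTED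
set `Z` of Galerkin steady states of the FIXED force `C` with `energy ≤ E`, `dissipation ∈ [ε, qε]`, viscosities
covering `[a j, r a j]`, one gets `LoudCoatDecades` with `νlo j := a j · E_C/ε`, `ρ := r/q`, `ε₁ := E_C³/(qε)²`,
`M := E_C³/ε²`, `E₁ := E (E_C/ε)²`, `E_C := ∑_{modes K₀} ‖Cfun k‖²` (`coatFamily_of_forceFamily` per `(j, N)` after
intersecting `∃ᶠ N` with `N ≥ K₀`, and `M < ρ²ε₁ ⟺ q² < r`). [folklore] -/
theorem stub_loudCoatOfLadder : (∃ (K₀ : ℕ) (Cfun : (Fin 3 → ℤ) → EuclideanSpace ℂ (Fin 3)), (∀ k ∉ modes (Fin 3) K₀, Cfun k = 0) ∧ ∃ (E ε q r : ℝ) (a : ℕ → ℝ), 0 < ε ∧ 1 ≤ q ∧ q ^ 2 < r ∧ (∀ j, 0 < a j) ∧ Tendsto a atTop (𝓝 0) ∧ ∀ j, ∃ᶠ N in atTop, ∃ C : ↥(modes (Fin 3) N) → EuclideanSpace ℂ (Fin 3), (C = fun k : ↥(modes (Fin 3) N) => Cfun k) ∧ (C ∈ galerkinSubspace (modes (Fin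 3) N) ∧ C ≠ 0 ∧ galerkinRHS (modes (Fin 3) N) 0 0 C = 0) ∧ ∃ Z : Set (ℝ × (↥(modes (Fin 3) N) → EuclideanSpace ℂ (Fin 3))), IsConnected Z ∧ (∀ p ∈ Z, p.2 ∈ galerkinSubspace (modes (Fin 3) N) ∧ galerkinRHS (modes (Fin 3) N) p.1 C p.2 = 0 ∧ energy p.2 ≤ E ∧ ε ≤ dissipation p.1 p.2 ∧ dissipation p.1 p.2 ≤ q * ε) ∧ Set.Icc (a j) (r * a j) ⊆ Prod.fst '' Z) → ∃ (K₀ : ℕ) (Cfun : (Fin 3 → ℤ) → EuclideanSpace ℂ (Fin 3)), (∀ k ∉ modes (Fin 3) K₀, Cfun k = 0) ∧ ∃ (E₁ ε₁ M ρ : ℝ) (νlo : ℕ → ℝ), 0 < ε₁ ∧ 0 < ρ ∧ M < ρ ^ 2 * ε₁ ∧ (∀ j, 0 < νlo j) ∧ Tendsto νlo atTop (𝓝 0) ∧ ∀ j, ∃ᶠ N in atTop, ∃ C : ↥(modes (Fin 3) N) → EuclideanSpace ℂ (Fin 3), (C = fun k : ↥(modes (Fin 3) N) => Cfun k) ∧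 (C ∈ galerkinSubspace (modes (Fin 3) N) ∧ C ≠ 0 ∧ galerkinRHS (modes (Fin 3) N) 0 0 C = 0) ∧ ∃ K : Set (ℝ × (↥(modes (Fin 3) N) → EuclideanSpace ℂ (Fin 3))), IsConnected K ∧ (∀ p ∈ K, (p.2 ∈ galerkinSubspace (modes (Fin 3) N) ∧ (∑ k, (inner ℂ (C k) (p.2 k)).re) = 0 ∧ ∃ s : ℝ, galerkinRHS (modes (Fin 3) N) p.1 0 (C + p.2) = (-s) • C) ∧ energy (C + p.2) ≤ E₁ ∧ ε₁ ≤ dissipation p.1 (C + p.2) ∧ dissipation p.1 (C + p.2) ≤ M) ∧ Set.Icc (νlo j) (ρ * νlo j) ⊆ Prod.fst '' K := by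
  rintro ⟨K₀, Cfun, hsupp, E, ε, q, r, a, hε, hq, hqr, ha, hlim, hL⟩
  -- the core energy, level-independent for `N ≥ K₀`, positive by the `j = 0` instance
  set EC : ℝ := ∑ k ∈ modes (Fin 3) K₀, ‖Cfun k‖ ^ 2 with hECdef
  obtain ⟨N₀, ⟨C₀, hC₀def, hC₀core, -⟩, hKN₀⟩ := ((hL 0).and_eventually (eventually_ge_atTop K₀)).exists
  have hEC0 : energy C₀ = EC := by rw [hC₀def]; exact energyRestrict hsupp hKN₀
  have hEC : 0 < EC := hEC0 ▸ energyPos hC₀core.2.1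
  have hq0 : 0 < q := one_pos.trans_le hq
  have hr1 : 1 < r := by nlinarith
  have hr0 : 0 < r := one_pos.trans hr1
  -- constants
  refine ⟨K₀, Cfun, hsupp, E * (EC / ε) ^ 2, EC ^ 3 / (q * ε) ^ 2, EC ^ 3 / ε ^ 2, r / q,
    fun j => a j * (EC / ε), by positivity, by positivity, ?_, fun j => by
      have := ha j
      positivity, ?_, fun j => ?_⟩
  · -- `M < ρ² ε₁ ⟺ q² < r`
    have hM : 0 < EC ^ 3 / ε ^ 2 := by positivity
    have hkey : (r / q) ^ 2 * (EC ^ 3 / (q * ε) ^ 2) = (r / q ^ 2) ^ 2 * (EC ^ 3 / ε ^ 2) := by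
      field_simp
    have h1 : 1 < r / q ^ 2 := (one_lt_div (by positivity)).2 hqr
    have h2 : 1 < (r / q ^ 2) ^ 2 := one_lt_pow₀ h1 two_ne_zero
    rw [hkey]
    exact lt_mul_left hM h2
  · simpa using hlim.mul_const (EC / ε)
  refine ((hL j).and_eventually (eventually_ge_atTop K₀)).mono ?_
  rintro N ⟨⟨C, hCdef, hCcore, Z, hZ, hZst, hcov⟩, hKN⟩
  have hCE : energy C = EC := by rw [hCdef]; exact energyRestrict hsupp hKN
  have haj : 0 < a j := ha j
  have hab : a j ≤ r * a j := by nlinarith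
  obtain ⟨K, hK, hKprop, hKcov⟩ :=
    coatFamily_of_forceFamily N C hCcore.1 Z E ε q (a j) (r * a j) hε haj hab hZ hZst hcov
  rw [hCE] at hKprop hKcov
  refine ⟨C, hCdef, hCcore, K, hK, hKprop, ?_⟩
  have e2 : r / q * (a j * (EC / ε)) = r * a j * (EC / (q * ε)) := by
    field_simp
  rw [e2]
  exact hKcov

end Summit.AnomalousDissipation.AnomalousDissipation.Theorems.GalerkinSteadyZerothLaw

end
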